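import Literature.NumberTheory.LFunctions.HyperbolaPrimeSumAbelSharp
import Literature.NumberTheory.Sieve.FriableMoebiusRootSumBaseLemmas
import HarnessLib

/-!
# The friable Möbius–root sum in the base range: the three discrete sums

Topic `Literature/NumberTheory/Sieve` (sequel to `FriableMoebiusRootSumBaseLemmas.lean`; consumed by
`FriableMoebiusRootSumBase.lean`). Everything here is PROVED; no definitions, no named facts. With
`ρ = ρ_g`, `w(n) = μ(n)ρ(n)/n`, `M(V) = ∑_{n ≤ V} w(n)`, `X = ⌊x⌋`, `N = ⌈y⌉`, `e³ ≤ y ≤ x ≤ y²`: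

* `abs_primeSum_sub_hyperbolaSum_le` — Abel summation through `ϑ_g`:
  `|∑_{N ≤ p ≤ X} (ρ(p)/p) M(⌊X/p⌋) − ∑_{N ≤ k ≤ X} M(⌊X/k⌋)/(k log k)| ≤ (C₀ + 4)(12B + 2K)/log² y`;
* `abs_hyperbolaSum_sub_sum_mul_loglog_le` — Dirichlet's swap and `∑ 1/(k log k) = log log + O(1/(N log N))`:
  `|∑_{N ≤ k ≤ X} M(⌊X/k⌋)/(k log k) − ∑_{n ≤ X/N} w(n)(log log (x/n) − log log y)| ≤ 48K/log² y`;
* `abs_sum_Icc_div_sub_sum_floor_le` — extending the range to `n ≤ x/y`: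
  `|∑_{n ≤ ⌊x/y⌋} w(n)(log log(x/n) − log log y) − ∑_{n ≤ X/N} …| ≤ 8K/log² y`.

Here `B` bounds `|M(V)|`, `K(1 + log V)` bounds `∑_{n ≤ V} μ²(n)ρ(n)/n`, `C₀` is the constant of
`ϑ_g(t) = t + O(t/log² t)`.

## References

* H. L. Montgomery, R. C. Vaughan, *Multiplicative Number Theory I*, CUP 2007, §2.1. [MontgomeryVaughan2007]
* G. Tenenbaum, *Introduction to analytic and probabilistic number theory*, Ch. III.6. [Tenenbaum2015]
-/

open Finset Real Polynomial

noncomputable section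

namespace Literature.NumberTheory.Sieve

namespace FriableMoebiusRoot

open Literature.NumberTheory.LFunctions

/-! ### Numerics of the base range -/

/-- The numerics of the base range `e³ ≤ y ≤ x`, `log x ≤ 2 log y`: with `N = ⌈y⌉`,
`20 ≤ y`, `3 ≤ log y`, `log(N − 1) ≥ log(y − 1) ≥ (log y)/2`, `log y ≤ log N`, `x ≤ y²`,
`1/(y − 1) ≤ 4/log² y`. [folklore] -/
theorem base_numerics {x y : ℝ} (hy : Real.exp 3 ≤ y) (hyx : y ≤ x) (hxy : Real.log x ≤ 2 * Real.log y) :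
    20 < y ∧ 3 ≤ Real.log y ∧ Real.log y / 2 ≤ Real.log (y - 1) ∧
      Real.log (y - 1) ≤ Real.log ((⌈y⌉₊ : ℝ) - 1) ∧ Real.log y ≤ Real.log (⌈y⌉₊ : ℝ) ∧
      x ≤ y ^ 2 ∧ 1 / (y - 1) ≤ 4 / Real.log y ^ 2 := by
  have he3 : (20 : ℝ) < Real.exp 3 := by
    have h := Real.exp_one_gt_d9
    have h3 : Real.exp 3 = Real.exp 1 ^ 3 := by rw [← Real.exp_nat_mul]; norm_num
    have h4 : (2.7182818283 : ℝ) ^ 3 ≤ Real.exp 1 ^ 3 := pow_le_pow_left₀ (by norm_num) h.le 3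
    rw [h3]; nlinarith
  have hy20 : 20 < y := he3.trans_le hy
  have hy0 : 0 < y := by linarith
  have hly : 3 ≤ Real.log y := by rw [Real.le_log_iff_exp_le hy0]; exact hy
  have hN : y ≤ (⌈y⌉₊ : ℝ) := Nat.le_ceil y
  -- `y − 1 ≥ √y`, so `log(y − 1) ≥ (log y)/2`
  have hsqrt : Real.sqrt y ≤ y - 1 := by
    rw [Real.sqrt_le_left (by linarith)]
    nlinarith
  have hlog1 : Real.log y / 2 ≤ Real.log (y - 1) := by
    rw [← Real.log_sqrt hy0.le]
    exact Real.log_le_log (Real.sqrt_pos.mpr hy0) hsqrt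
  have hx : x ≤ y ^ 2 := by
    have hx0 : 0 < x := by linarith
    calc x = Real.exp (Real.log x) := (Real.exp_log hx0).symm
      _ ≤ Real.exp (2 * Real.log y) := Real.exp_le_exp.mpr hxy
      _ = y ^ 2 := by
          rw [show 2 * Real.log y = Real.log (y ^ 2) by rw [Real.log_pow]; norm_num, Real.exp_log (by positivity)]
  -- `log² y ≤ 4(y − 1)`
  have hlog4 : Real.log y ^ 2 ≤ 4 * (y - 1) := by
    have h1 : Real.log (Real.sqrt y) ≤ Real.sqrt y - 1 := Real.log_le_sub_one_of_pos (Real.sqrt_pos.mpr hy0)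
    have h2 : Real.log (Real.sqrt y) = Real.log y / 2 := by rw [Real.log_sqrt hy0.le]
    have h3 : Real.sqrt y ^ 2 = y := Real.sq_sqrt hy0.le
    have h4 : 1 ≤ Real.sqrt y := by rw [Real.le_sqrt zero_le_one hy0.le]; norm_num; linarith
    have hl0 : 0 ≤ Real.log y := by linarith
    have hb : Real.log y ≤ 2 * (Real.sqrt y - 1) := by linarith
    nlinarith [mul_le_mul hb hb hl0 (by linarith)]
  refine ⟨hy20, hly, hlog1, Real.log_le_log (by linarith) (by linarith), Real.log_le_log hy0 hN, hx, ?_⟩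
  rw [div_le_div_iff₀ (by linarith) (by positivity)]
  linarith

/-! ### Abel summation through `ϑ_g` -/

/-- **`∑_{N ≤ p ≤ X} (ρ(p)/p) M(⌊X/p⌋) = ∑_{N ≤ k ≤ X} M(⌊X/k⌋)/(k log k) + O(1/log² y)`** in the base
range: with `|ϑ_g(t) − t| ≤ C₀ t/log² t`, `|M(V)| ≤ B` (`B ≥ 1`) and
`∑_{m ≤ V} μ²(m)ρ(m)/m ≤ K(1 + log V)`, for `e³ ≤ y ≤ x`, `log x ≤ 2 log y`, `X = ⌊x⌋`, `N = ⌈y⌉`: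
the difference is at most `(C₀ + 4)(12B + 2K)/log² y`
(`HyperbolaAbel.abs_sum_weight_mul_sub_sum_le_sharp`). [cite: MontgomeryVaughan2007, §2.1] -/
theorem abs_primeSum_sub_hyperbolaSum_le {g : ℤ[X]} {C₀ B K : ℝ} (hC₀ : 0 ≤ C₀) (hB1 : 1 ≤ B)
    (hK0 : 0 ≤ K)
    (hθ : ∀ t : ℝ, 2 ≤ t →
      |∑ p ∈ Nat.primesLE ⌊t⌋₊, (polyRootCountMod ![g] p : ℝ) * Real.log p - t| ≤ C₀ * t / Real.log t ^ 2)
    (hB : ∀ V : ℕ,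
      |∑ n ∈ Icc 1 V, (ArithmeticFunction.moebius n : ℝ) * (polyRootCountMod ![g] n : ℝ) / n| ≤ B)
    (hK : ∀ V : ℕ, ∑ m ∈ Icc 1 V, (ArithmeticFunction.moebius m : ℝ) ^ 2 *
      (polyRootCountMod ![g] m : ℝ) / m ≤ K * (1 + Real.log V))
    {x y : ℝ} (hy : Real.exp 3 ≤ y) (hyx : y ≤ x) (hxy : Real.log x ≤ 2 * Real.log y) :
    |∑ p ∈ (Finset.Ico ⌈y⌉₊ (⌊x⌋₊ + 1)).filter Nat.Prime, (polyRootCountMod ![g] p : ℝ) / p *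
        ∑ n ∈ Icc 1 (⌊x⌋₊ / p), (ArithmeticFunction.moebius n : ℝ) * (polyRootCountMod ![g] n : ℝ) / n -
      ∑ k ∈ Icc ⌈y⌉₊ ⌊x⌋₊, (∑ n ∈ Icc 1 (⌊x⌋₊ / k),
        (ArithmeticFunction.moebius n : ℝ) * (polyRootCountMod ![g] n : ℝ) / n) / ((k : ℝ) * Real.log k)| ≤
      (C₀ + 4) * (12 * B + 2 * K) / Real.log y ^ 2 := by
  obtain ⟨hy20, hly3, hlog1, hlog2, hlogN, hx2, -⟩ := base_numerics hy hyx hxy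
  set X := ⌊x⌋₊ with hX
  set N := ⌈y⌉₊ with hN
  set w : ℕ → ℝ := fun n => (ArithmeticFunction.moebius n : ℝ) * (polyRootCountMod ![g] n : ℝ) / n with hw
  set c : ℕ → ℝ := fun k => if k.Prime then (polyRootCountMod ![g] k : ℝ) * Real.log k else 0 with hc
  have hy0 : 0 < y := by linarith
  have hx0 : 0 < x := by linarith
  have hly : 0 < Real.log y := by linarith
  have hNy : y ≤ N := Nat.le_ceil y
  have hN21 : 21 ≤ N := Nat.lt_ceil.mpr (by exact_mod_cast hy20)
  have hres : 0 ≤ (C₀ + 4) * (12 * B + 2 * K) / Real.log y ^ 2 := by positivity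
  rcases Nat.lt_or_ge X N with hXN | hNX
  · -- empty ranges
    have h1 : (Finset.Ico N (X + 1)).filter Nat.Prime = ∅ := by
      rw [Finset.filter_eq_empty_iff]; intro p hp; simp only [Finset.mem_Ico] at hp; omega
    have h2 : Finset.Icc N X = ∅ := Finset.Icc_eq_empty_of_lt hXN
    rw [h1, h2, sum_empty, sum_empty, sub_zero, abs_zero]
    exact hres
  -- the sharp Abel summation
  have hIcc : Finset.Ico N (X + 1) = Finset.Icc N X := Finset.Ico_succ_right_eq_Icc N X
  have hK' : ∑ n ∈ Icc 1 (X / N), |w n| ≤ K * (1 + Real.log ((X / N : ℕ) : ℝ)) := by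
    refine le_trans (le_of_eq (Finset.sum_congr rfl fun n _ => ?_)) (hK (X / N))
    simp only [hw]
    rw [abs_div, abs_mul, abs_moebius_eq_sq, Nat.abs_cast, Nat.abs_cast]
  have hD : ∀ k : ℕ, N - 1 ≤ k → |∑ i ∈ range (k + 1), (c i - 1)| ≤ (C₀ + 4) * k / Real.log k ^ 2 :=
    fun k hk => abs_sum_range_primeWeight_sub_le hθ (by omega)
  have hmain := HyperbolaAbel.abs_sum_weight_mul_sub_sum_le_sharp w c (by omega) hNX
    (by linarith) (by positivity) hB hK' hD
  -- the left sum is the prime sum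
  have hsum : ∑ k ∈ Icc N X, c k * ((∑ n ∈ Icc 1 (X / k), w n) / ((k : ℝ) * Real.log k)) =
      ∑ p ∈ (Finset.Ico N (X + 1)).filter Nat.Prime,
        (polyRootCountMod ![g] p : ℝ) / p * ∑ n ∈ Icc 1 (X / p), w n := by
    rw [hIcc, Finset.sum_filter]
    refine Finset.sum_congr rfl fun k hk => ?_
    simp only [hc]
    split_ifs with hkp
    · have hk0 : (0 : ℝ) < k := by exact_mod_cast hkp.pos
      have hlk : 0 < Real.log k := Real.log_pos (by exact_mod_cast hkp.one_lt)
      field_simp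
    · rw [zero_mul]
  rw [hsum] at hmain
  refine hmain.trans ?_
  -- numerics: `log(N − 1) ≥ (log y)/2`, `log N ≥ log y`, `K' ≤ 2K log y`
  have hlN1 : Real.log y / 2 ≤ Real.log ((N : ℝ) - 1) := hlog1.trans hlog2
  have hlN1pos : 0 < Real.log ((N : ℝ) - 1) := by linarith
  have hlogXN : Real.log ((X / N : ℕ) : ℝ) ≤ Real.log y := by
    rcases Nat.eq_zero_or_pos (X / N) with h0 | hpos
    · rw [h0]; simp; linarith
    · refine Real.log_le_log (by exact_mod_cast hpos) ?_
      calc ((X / N : ℕ) : ℝ) ≤ (X : ℝ) / N := Nat.cast_div_le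
        _ ≤ x / y := by
            refine div_le_div₀ hx0.le (Nat.floor_le hx0.le) hy0 hNy
        _ ≤ y := by rw [div_le_iff₀ hy0]; nlinarith
  have e1 : (C₀ + 4) * (3 * B) / Real.log ((N : ℝ) - 1) ^ 2 ≤ (C₀ + 4) * (12 * B) / Real.log y ^ 2 := by
    rw [div_le_div_iff₀ (by positivity) (by positivity)]
    have h4 : Real.log y ^ 2 ≤ 4 * Real.log ((N : ℝ) - 1) ^ 2 := by nlinarith
    have h0 : 0 ≤ (C₀ + 4) * (3 * B) := by positivity
    nlinarith [mul_le_mul_of_nonneg_left h4 h0]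
  have e2 : (C₀ + 4) * (K * (1 + Real.log ((X / N : ℕ) : ℝ))) / Real.log (N : ℝ) ^ 3 ≤
      (C₀ + 4) * (2 * K) / Real.log y ^ 2 := by
    have hlN : Real.log y ≤ Real.log (N : ℝ) := hlogN
    calc (C₀ + 4) * (K * (1 + Real.log ((X / N : ℕ) : ℝ))) / Real.log (N : ℝ) ^ 3
        ≤ (C₀ + 4) * (K * (2 * Real.log y)) / Real.log y ^ 3 := by
          refine div_le_div₀ (by positivity) ?_ (by positivity) ?_
          · refine mul_le_mul_of_nonneg_left (mul_le_mul_of_nonneg_left (by linarith) hK0) (by positivity)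
          · exact pow_le_pow_left₀ hly.le hlN 3
      _ = (C₀ + 4) * (2 * K) / Real.log y ^ 2 := by field_simp
  have hsplit : (C₀ + 4) * (12 * B + 2 * K) / Real.log y ^ 2 =
      (C₀ + 4) * (12 * B) / Real.log y ^ 2 + (C₀ + 4) * (2 * K) / Real.log y ^ 2 := by ring
  linarith

/-! ### Dirichlet's swap and the harmonic sums -/

/-- **Dirichlet's swap and `∑ 1/(k log k)`** in the base range: with `φ(n) = log log(x/n) − log log y`
written as `log(log x − log n) − log(log x − log(x/y))`,
`|∑_{N ≤ k ≤ X} M(⌊X/k⌋)/(k log k) − ∑_{n ≤ X/N} w(n) φ(n)| ≤ 48K/log² y`. [cite: Tenenbaum2015, Ch. III.6] -/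
theorem abs_hyperbolaSum_sub_sum_mul_loglog_le {g : ℤ[X]} {K : ℝ} (hK0 : 0 ≤ K)
    (hK : ∀ V : ℕ, ∑ m ∈ Icc 1 V, (ArithmeticFunction.moebius m : ℝ) ^ 2 *
      (polyRootCountMod ![g] m : ℝ) / m ≤ K * (1 + Real.log V))
    {x y : ℝ} (hy : Real.exp 3 ≤ y) (hyx : y ≤ x) (hxy : Real.log x ≤ 2 * Real.log y) :
    |∑ k ∈ Icc ⌈y⌉₊ ⌊x⌋₊, (∑ n ∈ Icc 1 (⌊x⌋₊ / k),
        (ArithmeticFunction.moebius n : ℝ) * (polyRootCountMod ![g] n : ℝ) / n) / ((k : ℝ) * Real.log k) -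
      ∑ n ∈ Icc 1 (⌊x⌋₊ / ⌈y⌉₊), (ArithmeticFunction.moebius n : ℝ) * (polyRootCountMod ![g] n : ℝ) / n *
        (Real.log (Real.log x - Real.log n) - Real.log (Real.log x - Real.log (x / y)))| ≤
      48 * K / Real.log y ^ 2 := by
  obtain ⟨hy20, hly3, hlog1, hlog2, hlogN, hx2, hy4⟩ := base_numerics hy hyx hxy
  set X := ⌊x⌋₊ with hX
  set N := ⌈y⌉₊ with hN
  set w : ℕ → ℝ := fun n => (ArithmeticFunction.moebius n : ℝ) * (polyRootCountMod ![g] n : ℝ) / n with hw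
  have hy0 : 0 < y := by linarith
  have hx0 : 0 < x := by linarith
  have hly : 0 < Real.log y := by linarith
  have hNy : y ≤ N := Nat.le_ceil y
  have hNy1 : (N : ℝ) < y + 1 := Nat.ceil_lt_add_one hy0.le
  have hN21 : 21 ≤ N := Nat.lt_ceil.mpr (by exact_mod_cast hy20)
  have hres : 0 ≤ 48 * K / Real.log y ^ 2 := by positivity
  have hlxy : Real.log x - Real.log (x / y) = Real.log y := by
    rw [Real.log_div hx0.ne' hy0.ne']; ring
  rw [hlxy]
  rcases Nat.lt_or_ge X N with hXN | hNX
  · have h2 : Finset.Icc N X = ∅ := Finset.Icc_eq_empty_of_lt hXN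
    have h3 : X / N = 0 := Nat.div_eq_of_lt hXN
    rw [h2, h3, sum_empty]
    simp only [show Finset.Icc 1 0 = ∅ from rfl, sum_empty, sub_zero, abs_zero]
    exact hres
  -- the swap
  rw [HyperbolaAbel.sum_partialSum_div_eq_sum_mul_sum w (by omega) X, ← Finset.sum_sub_distrib]
  -- per-`n` comparison of the harmonic sum with `φ(n)`
  have hper : ∀ n ∈ Icc 1 (X / N),
      |∑ k ∈ Icc N (X / n), 1 / ((k : ℝ) * Real.log k) -
        (Real.log (Real.log x - Real.log n) - Real.log (Real.log y))| ≤ 6 / ((y - 1) * Real.log y) := by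
    intro n hn
    obtain ⟨hn1, hnX⟩ := Finset.mem_Icc.mp hn
    have hn0 : (0 : ℝ) < n := by exact_mod_cast hn1
    have hNq : N ≤ X / n := (Nat.le_div_iff_mul_le (by omega)).mpr
      (by have := (Nat.le_div_iff_mul_le (by omega : 0 < N)).mp hnX; linarith [Nat.mul_comm n N])
    set q := X / n with hq
    have hqfloor : q = ⌊x / n⌋₊ := by rw [hq, hX, Nat.floor_div_natCast]
    have hq2 : (21 : ℝ) ≤ q := by exact_mod_cast le_trans hN21 hNq
    have hqx : (q : ℝ) ≤ x / n := by rw [hqfloor]; exact Nat.floor_le (by positivity)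
    have hxq : x / n < q + 1 := by rw [hqfloor]; exact Nat.lt_floor_add_one _
    have hD := HyperbolaAbel.abs_sum_inv_mul_log_sub_loglog_le (N := N) (K := q) (by omega) (by omega)
    -- the three small differences, each `≤ 1/((y−1) log(y−1))`
    have hylog : 0 < (y - 1) * Real.log (y - 1) := mul_pos (by linarith) (by linarith)
    have hmono : ∀ t : ℝ, y - 1 ≤ t → 1 / (t * Real.log t) ≤ 1 / ((y - 1) * Real.log (y - 1)) := by
      intro t ht
      have hlt : Real.log (y - 1) ≤ Real.log t := Real.log_le_log (by linarith) ht
      exact one_div_le_one_div_of_le hylog (mul_le_mul ht hlt (by linarith) (by linarith))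
    have e1 : 1 / (((N : ℝ) - 1) * Real.log ((N : ℝ) - 1)) ≤ 1 / ((y - 1) * Real.log (y - 1)) :=
      hmono _ (by linarith)
    have e2 : |Real.log (Real.log ((q : ℝ) + 1)) - Real.log (Real.log x - Real.log n)| ≤
        1 / ((y - 1) * Real.log (y - 1)) := by
      have hlxn : Real.log x - Real.log n = Real.log (x / n) := (Real.log_div hx0.ne' hn0.ne').symm
      rw [hlxn]
      have hq1 : (1 : ℝ) < q := by linarith
      have hlq : 0 < Real.log q := Real.log_pos hq1
      have hup : Real.log (Real.log (x / n)) ≤ Real.log (Real.log ((q : ℝ) + 1)) :=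
        Real.log_le_log (by rw [← Real.log_one]; exact Real.log_lt_log one_pos (by linarith))
          (Real.log_le_log (by positivity) hxq.le)
      have hlow : Real.log (Real.log q) ≤ Real.log (Real.log (x / n)) :=
        Real.log_le_log hlq (Real.log_le_log (by positivity) hqx)
      rw [abs_of_nonneg (by linarith)]
      calc Real.log (Real.log ((q : ℝ) + 1)) - Real.log (Real.log (x / n))
          ≤ Real.log (Real.log ((q : ℝ) + 1)) - Real.log (Real.log q) := by linarith
        _ ≤ 1 / ((q : ℝ) * Real.log q) := loglog_add_one_sub_loglog_le hq1
        _ ≤ 1 / ((y - 1) * Real.log (y - 1)) := hmono _ (by linarith [show (y:ℝ) ≤ q from hNy.trans (by exact_mod_cast hNq)])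
    have e3 : |Real.log (Real.log (N : ℝ)) - Real.log (Real.log y)| ≤ 1 / ((y - 1) * Real.log (y - 1)) := by
      rw [abs_of_nonneg (by linarith [Real.log_le_log hly hlogN])]
      calc Real.log (Real.log (N : ℝ)) - Real.log (Real.log y)
          ≤ Real.log (Real.log (y + 1)) - Real.log (Real.log y) := by
            linarith [Real.log_le_log (by linarith : 0 < Real.log (N:ℝ)) (Real.log_le_log (by linarith) hNy1.le)]
        _ ≤ 1 / (y * Real.log y) := loglog_add_one_sub_loglog_le (by linarith)
        _ ≤ 1 / ((y - 1) * Real.log (y - 1)) := hmono y (by linarith)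
    have hsum3 : 3 * (1 / ((y - 1) * Real.log (y - 1))) ≤ 6 / ((y - 1) * Real.log y) := by
      rw [show 6 / ((y - 1) * Real.log y) = 3 * (1 / ((y - 1) * (Real.log y / 2))) by field_simp; ring]
      refine mul_le_mul_of_nonneg_left (one_div_le_one_div_of_le (mul_pos (by linarith) (by linarith)) ?_)
        (by norm_num)
      exact mul_le_mul_of_nonneg_left hlog1 (by linarith)
    have htri := abs_sub_le (∑ k ∈ Icc N q, 1 / ((k : ℝ) * Real.log k))
      (Real.log (Real.log ((q : ℝ) + 1)) - Real.log (Real.log (N : ℝ)))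
      (Real.log (Real.log x - Real.log n) - Real.log (Real.log y))
    have hmid : |(Real.log (Real.log ((q : ℝ) + 1)) - Real.log (Real.log (N : ℝ))) -
        (Real.log (Real.log x - Real.log n) - Real.log (Real.log y))| ≤
        2 * (1 / ((y - 1) * Real.log (y - 1))) := by
      rw [show (Real.log (Real.log ((q : ℝ) + 1)) - Real.log (Real.log (N : ℝ))) -
        (Real.log (Real.log x - Real.log n) - Real.log (Real.log y)) =
        (Real.log (Real.log ((q : ℝ) + 1)) - Real.log (Real.log x - Real.log n)) -
          (Real.log (Real.log (N : ℝ)) - Real.log (Real.log y)) by ring]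
      refine (abs_sub _ _).trans ?_
      linarith
    linarith
  -- sum over `n`
  have hKsum : ∑ n ∈ Icc 1 (X / N), |w n| ≤ 2 * K * Real.log y := by
    have h1 : ∑ n ∈ Icc 1 (X / N), |w n| ≤ K * (1 + Real.log ((X / N : ℕ) : ℝ)) := by
      refine le_trans (le_of_eq (Finset.sum_congr rfl fun n _ => ?_)) (hK (X / N))
      simp only [hw]
      rw [abs_div, abs_mul, abs_moebius_eq_sq, Nat.abs_cast, Nat.abs_cast]
    have hlogXN : Real.log ((X / N : ℕ) : ℝ) ≤ Real.log y := by
      rcases Nat.eq_zero_or_pos (X / N) with h0 | hpos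
      · rw [h0]; simp; linarith
      · refine Real.log_le_log (by exact_mod_cast hpos) ?_
        calc ((X / N : ℕ) : ℝ) ≤ (X : ℝ) / N := Nat.cast_div_le
          _ ≤ x / y := div_le_div₀ hx0.le (Nat.floor_le hx0.le) hy0 hNy
          _ ≤ y := by rw [div_le_iff₀ hy0]; nlinarith
    nlinarith
  calc |∑ n ∈ Icc 1 (X / N), (w n * ∑ k ∈ Icc N (X / n), 1 / ((k : ℝ) * Real.log k) -
        w n * (Real.log (Real.log x - Real.log n) - Real.log (Real.log y)))|
      ≤ ∑ n ∈ Icc 1 (X / N), |w n * ∑ k ∈ Icc N (X / n), 1 / ((k : ℝ) * Real.log k) -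
          w n * (Real.log (Real.log x - Real.log n) - Real.log (Real.log y))| := Finset.abs_sum_le_sum_abs _ _
    _ ≤ ∑ n ∈ Icc 1 (X / N), |w n| * (6 / ((y - 1) * Real.log y)) := by
        refine Finset.sum_le_sum fun n hn => ?_
        rw [← mul_sub, abs_mul]
        exact mul_le_mul_of_nonneg_left (hper n hn) (abs_nonneg _)
    _ = (∑ n ∈ Icc 1 (X / N), |w n|) * (6 / ((y - 1) * Real.log y)) := (Finset.sum_mul _ _ _).symm
    _ ≤ (2 * K * Real.log y) * (6 / ((y - 1) * Real.log y)) :=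
        mul_le_mul_of_nonneg_right hKsum (div_nonneg (by norm_num) (mul_nonneg (by linarith) hly.le))
    _ = 12 * K * (1 / (y - 1)) := by field_simp; ring
    _ ≤ 12 * K * (4 / Real.log y ^ 2) := mul_le_mul_of_nonneg_left hy4 (by positivity)
    _ = 48 * K / Real.log y ^ 2 := by ring

/-! ### Extending the range to `n ≤ x/y` -/

/-- **Extending the `n`-range from `X/N` to `⌊x/y⌋`** costs `≤ 8K/log² y`: for `X/N < n ≤ x/y` one has
`y ≤ x/n < y + 1`, so `0 ≤ φ(n) ≤ log log(y+1) − log log y ≤ 1/(y log y)`. [folklore] -/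
theorem abs_sum_floor_sub_sum_div_le {g : ℤ[X]} {K : ℝ} (hK0 : 0 ≤ K)
    (hK : ∀ V : ℕ, ∑ m ∈ Icc 1 V, (ArithmeticFunction.moebius m : ℝ) ^ 2 *
      (polyRootCountMod ![g] m : ℝ) / m ≤ K * (1 + Real.log V))
    {x y : ℝ} (hy : Real.exp 3 ≤ y) (hyx : y ≤ x) (hxy : Real.log x ≤ 2 * Real.log y) :
    |∑ n ∈ Icc 1 ⌊x / y⌋₊, (ArithmeticFunction.moebius n : ℝ) * (polyRootCountMod ![g] n : ℝ) / n *
        (Real.log (Real.log x - Real.log n) - Real.log (Real.log x - Real.log (x / y))) -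
      ∑ n ∈ Icc 1 (⌊x⌋₊ / ⌈y⌉₊), (ArithmeticFunction.moebius n : ℝ) * (polyRootCountMod ![g] n : ℝ) / n *
        (Real.log (Real.log x - Real.log n) - Real.log (Real.log x - Real.log (x / y)))| ≤
      8 * K / Real.log y ^ 2 := by
  obtain ⟨hy20, hly3, -, -, hlogN, hx2, hy4⟩ := base_numerics hy hyx hxy
  set X := ⌊x⌋₊ with hX
  set N := ⌈y⌉₊ with hN
  set W := ⌊x / y⌋₊ with hW
  set w : ℕ → ℝ := fun n => (ArithmeticFunction.moebius n : ℝ) * (polyRootCountMod ![g] n : ℝ) / n with hw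
  set φ : ℕ → ℝ := fun n => Real.log (Real.log x - Real.log n) - Real.log (Real.log x - Real.log (x / y)) with hφ
  have hy0 : 0 < y := by linarith
  have hx0 : 0 < x := by linarith
  have hly : 0 < Real.log y := by linarith
  have hNy : y ≤ N := Nat.le_ceil y
  have hNy1 : (N : ℝ) < y + 1 := Nat.ceil_lt_add_one hy0.le
  have hN0 : 0 < N := by have := Nat.lt_ceil.mpr (show ((0:ℕ):ℝ) < y by push_cast; exact hy0); omega
  have hlxy : Real.log x - Real.log (x / y) = Real.log y := by rw [Real.log_div hx0.ne' hy0.ne']; ring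
  -- `X/N ≤ W`
  have hXNW : X / N ≤ W := by
    rw [hW, hX, ← Nat.floor_div_natCast]
    exact Nat.floor_le_floor (div_le_div_of_nonneg_left hx0.le hy0 hNy)
  have hsplit : Finset.Icc 1 W = Finset.Icc 1 (X / N) ∪ Finset.Ioc (X / N) W := by
    generalize hQ : X / N = Q at hXNW
    ext n; simp only [Finset.mem_union, Finset.mem_Icc, Finset.mem_Ioc]; omega
  have hdisj : Disjoint (Finset.Icc 1 (X / N)) (Finset.Ioc (X / N) W) := by
    generalize hQ : X / N = Q at hXNW
    rw [Finset.disjoint_left]; intro n h1 h2; simp only [Finset.mem_Icc, Finset.mem_Ioc] at h1 h2; omega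
  change |∑ n ∈ Icc 1 W, w n * φ n - ∑ n ∈ Icc 1 (X / N), w n * φ n| ≤ _
  rw [hsplit, Finset.sum_union hdisj, add_sub_cancel_left]
  -- on the extra range `0 ≤ φ(n) ≤ 1/(y log y)`
  have hφb : ∀ n ∈ Finset.Ioc (X / N) W, |φ n| ≤ 1 / (y * Real.log y) := by
    intro n hn
    obtain ⟨hn1, hn2⟩ := Finset.mem_Ioc.mp hn
    have hn0 : (0 : ℝ) < n := by exact_mod_cast lt_of_le_of_lt (Nat.zero_le _) hn1
    have hlxn : Real.log x - Real.log n = Real.log (x / n) := (Real.log_div hx0.ne' hn0.ne').symm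
    -- `x/n < N ≤ y + 1` and `x/n ≥ y`
    have h1 : x / n < N := by
      have : X / N + 1 ≤ n := hn1
      have hfl : ⌊x / N⌋₊ = X / N := by rw [hX, Nat.floor_div_natCast]
      have hlt : x / N < n := by
        have := Nat.lt_floor_add_one (x / N)
        rw [hfl] at this
        exact this.trans_le (by exact_mod_cast hn1)
      have hN0' : (0:ℝ) < N := by exact_mod_cast hN0
      rw [div_lt_iff₀ hn0]; rw [div_lt_iff₀ hN0'] at hlt; linarith
    have h2 : y ≤ x / n := by
      have : (n : ℝ) ≤ x / y := le_trans (by exact_mod_cast hn2) (Nat.floor_le (by positivity))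
      rw [le_div_iff₀ hn0]; rw [le_div_iff₀ hy0] at this; linarith
    simp only [hφ]
    rw [hlxy, hlxn]
    have hlo : Real.log (Real.log y) ≤ Real.log (Real.log (x / n)) :=
      Real.log_le_log hly (Real.log_le_log hy0 h2)
    have hhi : Real.log (Real.log (x / n)) ≤ Real.log (Real.log (y + 1)) :=
      Real.log_le_log (by linarith [Real.log_le_log hy0 h2]) (Real.log_le_log (by positivity) (by linarith))
    rw [abs_of_nonneg (by linarith)]
    linarith [loglog_add_one_sub_loglog_le (by linarith : (1:ℝ) < y)]
  have hKW : ∑ n ∈ Finset.Ioc (X / N) W, |w n| ≤ 2 * K * Real.log y := by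
    have h1 : ∑ n ∈ Finset.Ioc (X / N) W, |w n| ≤ ∑ n ∈ Finset.Icc 1 W, |w n| :=
      Finset.sum_le_sum_of_subset_of_nonneg (by rw [hsplit]; exact Finset.subset_union_right)
        fun _ _ _ => abs_nonneg _
    have h2 : ∑ n ∈ Finset.Icc 1 W, |w n| ≤ K * (1 + Real.log (W : ℝ)) := by
      refine le_trans (le_of_eq (Finset.sum_congr rfl fun n _ => ?_)) (hK W)
      simp only [hw]
      rw [abs_div, abs_mul, abs_moebius_eq_sq, Nat.abs_cast, Nat.abs_cast]
    have hlogW : Real.log (W : ℝ) ≤ Real.log y := by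
      rcases Nat.eq_zero_or_pos W with h0 | hpos
      · rw [h0]; simp; linarith
      · refine Real.log_le_log (by exact_mod_cast hpos) ?_
        calc (W : ℝ) ≤ x / y := Nat.floor_le (by positivity)
          _ ≤ y := by rw [div_le_iff₀ hy0]; nlinarith
    nlinarith
  have hy1 : 1 / y ≤ 4 / Real.log y ^ 2 := (one_div_le_one_div_of_le (by linarith) (by linarith)).trans hy4
  calc |∑ n ∈ Finset.Ioc (X / N) W, w n * φ n| ≤ ∑ n ∈ Finset.Ioc (X / N) W, |w n * φ n| :=
        Finset.abs_sum_le_sum_abs _ _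
    _ ≤ ∑ n ∈ Finset.Ioc (X / N) W, |w n| * (1 / (y * Real.log y)) := by
        refine Finset.sum_le_sum fun n hn => ?_
        rw [abs_mul]
        exact mul_le_mul_of_nonneg_left (hφb n hn) (abs_nonneg _)
    _ = (∑ n ∈ Finset.Ioc (X / N) W, |w n|) * (1 / (y * Real.log y)) := (Finset.sum_mul _ _ _).symm
    _ ≤ (2 * K * Real.log y) * (1 / (y * Real.log y)) := mul_le_mul_of_nonneg_right hKW (by positivity)
    _ = 2 * K * (1 / y) := by field_simp
    _ ≤ 2 * K * (4 / Real.log y ^ 2) := mul_le_mul_of_nonneg_left hy1 (by positivity)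
    _ = 8 * K / Real.log y ^ 2 := by ring

end FriableMoebiusRoot

end Literature.NumberTheory.Sieve
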